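import Summits.HubbardSuperconductivity.HubbardSuperconductivity.Theses.InfiniteVolumeFirst
import Summits.HubbardSuperconductivity.HubbardSuperconductivity.Theorems.InfiniteVolumeFirstTightnessExchange
import Summits.HubbardSuperconductivity.HubbardSuperconductivity.Theorems.NoInfraredPileUp.Negative.AllSectorStates
import Summits.HubbardSuperconductivity.HubbardSuperconductivity.Theorems.NoInfraredPileUp.Negative.NearGroundStates
import Summits.HubbardSuperconductivity.HubbardSuperconductivity.Theorems.NoInfraredPileUp.Negative.WithZeroMode
import Summits.HubbardSuperconductivity.HubbardSuperconductivity.Theorems.NoInfraredPileUp.Negative.UniformNormalForm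
import Summits.HubbardSuperconductivity.HubbardSuperconductivity.Theorems.FunctionFieldCertificateAssemblyFejerGlue
import Summits.HubbardSuperconductivity.HubbardSuperconductivity.Theorems.WindowInfraredBound.Negative.ParsevalCeiling
import Summits.HubbardSuperconductivity.HubbardSuperconductivity.Theorems.WindowInfraredBound.Negative.LoadBearing
import Summits.HubbardSuperconductivity.HubbardSuperconductivity.Theorems.FunctionFieldCertificateWindowInfraredBoundMesoscopicCeilingMajorant
import Literature.Barriers.HubbardSuperconductivity.PureModelStripeCompetitionProofs

/-!
# Disproof of `NoInfraredPileUp` — findings (standing disprover, cdisprove cycle 1, 2026-08-17)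

Crux (item `stmt-HubbardSuperconductivity-18534`; route InfiniteVolumeFirst, rank 3; the route's other
items — 18535 `TightnessExchange`, 18536 `Assembly` — are PROVED, 18533 `NoNormalLimitState` is the rank-2 crux):

  `∀ δ ∈ (0,1/2) ∃ U₁ > 0 ∀ U ∈ (0,U₁) ∀ admissible (N, ψ)  ∀ η > 0 ∃ ε > 0 ∃ L₀ ∀ even L ≥ L₀ (L ≠ 0),`
  `   T_ε(ψ_L) := Σ_{m ≠ 0, |q_m|² ≤ ε²} S_{ψ_L}(m) ≤ η L²`,   `S_ψ(m) = ‖Δ_d(m)ψ‖²/L²` (`pairStructureFactor`),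

admissible = at every even `L`: `N L = 2⌊(1-δ)L²/2⌋`, `‖ψ_L‖ = 1`, `ψ_L` a ground state of `hubbardTorus 2 L 1 U`
in the joint sector `(N L, S^z = 0)` (`IsGroundStateInSector` = membership ∧ `≠ 0` ∧ exact eigen-equation at
`minEnergyOn`).

READ-BACK (probe `W.lean`, rc 0).  No junk: `NeZero L` guards the conclusion, `momentumNormSq` uses
`valMinAbs` (momenta near `2π` count as small), `pairStructureFactor ≥ 0` is a genuine real; the side `L = 0`
is admissible-satisfiable (empty torus, vacuum, zero Hamiltonian) and unused by the conclusion (`∃ L₀`).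
NOT vacuous (unit sector ground states exist at every `(U, L, δ ≥ -1)`:
`exists_unit_isGroundStateInSector_hubbardTorus`), NOT trivial (Parseval gives only `T_ε ≤ 32 L²`, §1).
Quantifier order matters exactly once: `∃ ε` BEFORE `∀ L` (with `∀ L ∃ ε` the window is empty, §1).

VERDICT AFTER CYCLE 1: **no kill; six negative-side files LANDED** (all kernel-checked, standard axioms):
* §2 `…/NoInfraredPileUp/Negative/AllSectorStates.lean` (p144890) — GROUND STATE ↦ SECTOR MEMBERSHIP: FALSE
  outright (twisted Dicke condensate, `T_ε ≥ L²/1152` at `|q| = 4π/L`, δ = 1/4, every U).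
* §2 `…/NoInfraredPileUp/Negative/NearGroundStates.lean` (p145689, strategist's WallSoft) — GROUND STATE ↦
  "unit sector vector within `8π²` of `E₀`": FALSE given weak-coupling torus LRO (the route's own regime):
  the LSM-twisted ground state carries `aL²/2 − 32π²` to `|q| = 4π/L`.
* §3 `…/NoInfraredPileUp/Negative/WithZeroMode.lean` (p145822) — drop the cut `m ≠ 0`: REFUTED BY THE ROUTE'S
  OWN RANK-2 CRUX (`NoNormalLimitState → ¬ WithZeroMode`, via the landed exchange lemma).
* §4 `…/NoInfraredPileUp/Negative/UniformNormalForm.lean` (p145826) — the crux IMPLIES (hence is equivalent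
  to, §4) its state-uniform normal form: `ε, L₀` depend on `(δ, U, η)` only, uniformly over all unit sector
  ground states of all large even tori.  Refutation surface = ONE bad ground state per large side.
* §5 `…/NoInfraredPileUp/Negative/PileUpForcesLimitAtom.lean` (p146003) — THE TYPED OBSTRUCTION, now a
  theorem: a non-tight normalised family has a torus-limit with condensate atom `≥ η/16 > 0`
  (`pileUpForcesLimitAtom`); corollaries `allNormalImpliesTight` and `limitODLRO_of_not_noInfraredPileUp` (the latter
  ALSO LANDED standalone: `…/Negative/KillIsCondensation.lean`, p146252):
  `¬ NoInfraredPileUp` ⇒ at some `δ`, in EVERY coupling interval `(0, U₁)`, an admissible Hubbard ground-state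
  family whose torus-limit has `d_{x²−y²}` ODLRO.

WHY IT RESISTS (§5): by the state-uniform normal form a kill is: some `δ`, couplings `U_n → 0`, one `η > 0`,
and for every window `ε` unit sector GROUND STATES of arbitrarily large even tori with `T_ε > ηL²` — exact
eigenvectors of the doped 2D Hubbard model with `Θ(L²)` `d`-wave pair weight at `0 < |q| ≤ ε`.  Every sector
vector with that property that the tree can build (§2: sliding Dicke condensates, LSM-twisted condensates)
is excluded ONLY by the energy, and nothing controls `IsGroundStateInSector (hubbardTorus 2 L 1 U)` at
`δ ∈ (0,1/2)`, `U > 0`, for all large `L` (no convergent expansion uniform in `L`; BCS scale `e^{-c/U²}` below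
every perturbative cutoff, `Literature.Barriers.HubbardSuperconductivity.WeakCouplingCeiling`).  Worse for a
disprover: by the Fejér MAJORANT (`windowSum_le_fejerMajorant`, landed) a non-tight family has mesoscopic
block pair order `≥ η/16` at every scale, hence (`pileUpForcesLimitAtom`, LANDED §5) a torus-limit with a
POSITIVE condensate atom — refuting the crux means PROVING weak-coupling infinite-volume `d`-wave pair
condensation of Hubbard ground states for a sequence `U_n → 0` (`limitODLRO_of_not_noInfraredPileUp`, §5):
the infinite-volume form of the summit's own conclusion.  Small models cannot bite (`∃ L₀`; the only ED-accessible even torus, `L = 4`, has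
smallest nonzero `|q| = π/2`); `U = 0` is excluded and flat anyway (sibling kit job `j015079`: `T_ε ≈ κε²L²`).

Everything below elaborates; NO `sorry`; prose only in docstrings.  Sibling work reused: the 1089
(`WindowInfraredBound`, linear-rate all-coupling strengthening; a proof of 1089 closes this crux, refuter Glue
on the item) disproof file `Cruxes/WindowInfraredBound/Disproof.lean` and its landed negatives
`Theorems/WindowInfraredBound/Negative/*`; the strategist's `STRATEGY-CENSUS.md`, `StrategistSketch.lean`,
`WallSoft.lean` in this directory.

## Index
* §1 `conclusion_of_thirtyTwo_le`, `conclusion_forall_side_exists_window` — calibration (Parseval; empty window).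
* §2 `NoInfraredPileUpAllSectorStates` + `noInfraredPileUp_false_without_groundState` (LANDED, unconditional);
  `WeakCouplingTorusLRO`, `NoInfraredPileUpNearGroundStates` + `noInfraredPileUp_false_nearGroundStates_of_lro`
  (LANDED, conditional); `withoutNormalisation` (note: collapses to a super-decay law, not refutable).
* §3 `NoInfraredPileUpWithZeroMode` + `noInfraredPileUp_false_withZeroMode_of_noNormalLimitState` (LANDED) and
  `noInfraredPileUp_of_withZeroMode` (the mutation is a strengthening).
* §4 `NoInfraredPileUpUniform` + `noInfraredPileUp_iff_uniform` (→ LANDED); strengthenings not refutable here: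
  `UniformFlatWindow` (false in kind under LRO, unprovable either way), coupling-uniform windows.
* §5 `PileUpForcesLimitAtom` + `pileUpForcesLimitAtom_holds` (LANDED), `AllNormalImpliesTight` (LANDED),
  `limitODLRO_of_not_noInfraredPileUp` (¬crux ⇒ weak-coupling infinite-volume ODLRO ground states),
  `blockOrder_of_badWindow`, `whyItResists`.
* §6 `attackLog` — regimes / families / hypotheses tried, literature, barriers, what a cycle 2 would do.
-/

set_option linter.dupNamespace false

noncomputable section

namespace Summit.HubbardSuperconductivity.HubbardSuperconductivity.Cruxes.NoInfraredPileUp.Disproof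

open Literature.MathematicalPhysics.QuantumLattice Literature.Probability.LatticeModels
  Literature.Barriers.HubbardSuperconductivity Matrix Finset Filter
open Summit.HubbardSuperconductivity.HubbardSuperconductivity.Theses.InfiniteVolumeFirst
open Summit.HubbardSuperconductivity.HubbardSuperconductivity.Theorems
open Summit.HubbardSuperconductivity.HubbardSuperconductivity.Theorems.WindowInfraredBound.Negative
open Summit.HubbardSuperconductivity.HubbardSuperconductivity.Theorems.NoInfraredPileUp.Negative
open scoped ComplexOrder Topology

/-! ## §1 Calibration: what is automatic -/

/-- **The conclusion is automatic for `η ≥ 32`** (Parseval ceiling `T_ε ≤ Σ_x‖P_xψ‖² ≤ 32L²`,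
`windowSum_le_thirtyTwo_mul_sq`, for EVERY family normalised at even sides — no sector, no Hamiltonian):
the crux has content only as `η → 0`, i.e. it forbids a POSITIVE FRACTION of the `O(L²)` pair budget from
escaping to `0 < |q| → 0`. Kennedy–Lieb–Shastry, PRL 61 (1988) 2582. [folklore] -/
theorem conclusion_of_thirtyTwo_le (ψ : ∀ L, Fock (Orb (FermionTorus 2 L)))
    (hψ : ∀ L, Even L → star (ψ L) ⬝ᵥ ψ L = 1) (η : ℝ) (hη : 32 ≤ η) :
    ∃ ε : ℝ, 0 < ε ∧ ∃ L₀ : ℕ, ∀ (L : ℕ) [NeZero L], Even L → L₀ ≤ L →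
      (∑ m : Fin 2 → ZMod L, if m ≠ 0 ∧ momentumNormSq L m ≤ ε ^ 2 then
          pairStructureFactor dWaveFormFactor L (ψ L) m else 0) ≤ η * (L : ℝ) ^ 2 :=
  ⟨1, one_pos, 0, fun L _ hE _ =>
    (windowSum_le_thirtyTwo_mul_sq L 1 (hψ L hE)).trans (mul_le_mul_of_nonneg_right hη (sq_nonneg _))⟩

/-- **Quantifier order: with `∀ L ∃ ε` the statement is empty.** At a fixed side every `η > 0` is served by
the window `ε = π/L`, which contains no nonzero label (`windowSum_eq_zero_of_sq_lt`): the crux's content sits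
entirely in `∃ ε` BEFORE `∀ L ≥ L₀` (windows of fixed aperture on growing tori, `≈ ε²L²/4π` modes). [folklore] -/
theorem conclusion_forall_side_exists_window (L : ℕ) [NeZero L] (φ : Fock (Orb (FermionTorus 2 L)))
    (η : ℝ) (hη : 0 ≤ η) :
    ∃ ε : ℝ, 0 < ε ∧ (∑ m : Fin 2 → ZMod L, if m ≠ 0 ∧ momentumNormSq L m ≤ ε ^ 2 then
        pairStructureFactor dWaveFormFactor L φ m else 0) ≤ η * (L : ℝ) ^ 2 := by
  have hL : (0 : ℝ) < L := Nat.cast_pos.2 (Nat.pos_of_ne_zero (NeZero.ne L))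
  refine ⟨Real.pi / L, by positivity, ?_⟩
  rw [windowSum_eq_zero_of_sq_lt L (by
    have h1 : Real.pi / L < 2 * Real.pi / L := by
      rw [div_lt_div_iff_of_pos_right hL]; linarith [Real.pi_pos]
    exact pow_lt_pow_left₀ h1 (by positivity) two_ne_zero) φ]
  positivity

/-! ## §2 Load-bearing: the ground-state property (and how much of it) -/

/-- MUTATION 1 — the crux with `IsGroundStateInSector (hubbardTorus 2 L 1 U) (N L) 0 (ψ L)` weakened to
sector membership `ψ L ∈ szSector (N L) 0` (normalisation kept; everything else verbatim). [folklore] -/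
def NoInfraredPileUpAllSectorStates : Prop :=
  ∀ δ ∈ Set.Ioo (0:ℝ) (1 / 2), ∃ U₁ : ℝ, 0 < U₁ ∧ ∀ U ∈ Set.Ioo (0:ℝ) U₁,
    ∀ (N : ℕ → ℕ) (ψ : ∀ L, Fock (Orb (FermionTorus 2 L))),
      (∀ L, Even L → N L = 2 * ⌊(1 - δ) * (L : ℝ) ^ 2 / 2⌋₊ ∧ star (ψ L) ⬝ᵥ ψ L = 1 ∧
          ψ L ∈ szSector (Λ := FermionTorus 2 L) (N L) 0) →
        ∀ η : ℝ, 0 < η → ∃ ε : ℝ, 0 < ε ∧ ∃ L₀ : ℕ, ∀ (L : ℕ) [NeZero L], Even L → L₀ ≤ L →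
          (∑ m : Fin 2 → ZMod L, if m ≠ 0 ∧ momentumNormSq L m ≤ ε ^ 2 then
              pairStructureFactor dWaveFormFactor L (ψ L) m else 0) ≤ η * (L : ℝ) ^ 2

/-- **Any proof must use the ground-state property** (LANDED, p144890, unconditional):
`NoInfraredPileUpAllSectorStates` is FALSE.  Witness at `δ = 1/4` (every `U`): the Lieb–Schultz–Mattis twist
of the Dicke condensate of `3t²` zero-momentum `d`-wave-bright pairs over `6t²` Bloch momenta on the torus of
side `12t` (`exists_sector_state_large_pairStructureFactor`, sibling negative file): a unit vector of the
sector `(2⌊(3/4)L²/2⌋, 0)` with `S(2ê₁) ≥ L²/1152` at `|q| = 4π/L`, inside every window for large `t`; so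
`η = 1/2000` has no `ε, L₀`.  A SLIDING (generalised, Girardeau-type) pair condensate lives in every sector;
only the energy excludes it. Dicke (1954); Yang, RMP 34 (1962) §5; Watanabe, JSP 177 (2019) §2.2.1. [folklore] -/
theorem noInfraredPileUp_false_without_groundState : ¬ NoInfraredPileUpAllSectorStates :=
  not_noInfraredPileUpAllSectorStates

/-- The route's own regime, as a hypothesis: at some doping, at arbitrarily weak coupling, SOME ground-state
family has `d`-wave pair long-range order `‖Δ_d ψ_L‖² ≥ a L⁴` along the large even sides (this follows from
the summit at that `(U, δ)`; the route's rank-2 crux + exchange are designed to produce it). [folklore] -/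
def WeakCouplingTorusLRO : Prop :=
  ∃ δ ∈ Set.Ioo (0:ℝ) (1 / 2), ∀ U₁ : ℝ, 0 < U₁ → ∃ U ∈ Set.Ioo (0:ℝ) U₁,
    ∃ a : ℝ, 0 < a ∧ ∃ L₁ : ℕ, ∀ (L : ℕ) [NeZero L], L₁ ≤ L → Even L →
      ∃ ψ : Fock (Orb (FermionTorus 2 L)), star ψ ⬝ᵥ ψ = 1 ∧
        IsGroundStateInSector (hubbardTorus 2 L 1 U) (2 * ⌊(1 - δ) * (L : ℝ) ^ 2 / 2⌋₊) 0 ψ ∧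
        a * (L : ℝ) ^ 4 ≤
          (star (pairField dWaveFormFactor L *ᵥ ψ) ⬝ᵥ (pairField dWaveFormFactor L *ᵥ ψ)).re

/-- MUTATION 2 — the crux with the ground-state hypothesis relaxed to "unit vector of the `(N_L, 0)` sector
with energy `Re⟨ψ, Hψ⟩ ≤ minEnergyOn + 8π²`" (an `O(1)` TOTAL-energy window above the sector ground energy,
out of `O(L²)`). [folklore] -/
def NoInfraredPileUpNearGroundStates : Prop :=
  ∀ δ ∈ Set.Ioo (0:ℝ) (1 / 2), ∃ U₁ : ℝ, 0 < U₁ ∧ ∀ U ∈ Set.Ioo (0:ℝ) U₁,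
    ∀ (N : ℕ → ℕ) (ψ : ∀ L, Fock (Orb (FermionTorus 2 L))),
      (∀ L, Even L → N L = 2 * ⌊(1 - δ) * (L : ℝ) ^ 2 / 2⌋₊ ∧ star (ψ L) ⬝ᵥ ψ L = 1 ∧
          ψ L ∈ szSector (Λ := FermionTorus 2 L) (N L) 0 ∧
          (star (ψ L) ⬝ᵥ (hubbardTorus 2 L 1 U *ᵥ ψ L)).re ≤
            (hubbardTorus 2 L 1 U).minEnergyOn (szSector (Λ := FermionTorus 2 L) (N L) 0) +
              8 * Real.pi ^ 2) →
        ∀ η : ℝ, 0 < η → ∃ ε : ℝ, 0 < ε ∧ ∃ L₀ : ℕ, ∀ (L : ℕ) [NeZero L], Even L → L₀ ≤ L →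
          (∑ m : Fin 2 → ZMod L, if m ≠ 0 ∧ momentumNormSq L m ≤ ε ^ 2 then
              pairStructureFactor dWaveFormFactor L (ψ L) m else 0) ≤ η * (L : ℝ) ^ 2

/-- **The ground-state property is needed at `O(1)` total-energy resolution** (LANDED, p145689; the
strategist's `WallSoft.lean`): in the route's own regime (`WeakCouplingTorusLRO`) Mutation 2 is FALSE — the
LSM-twisted ground state `G_{±1}ψ_L` costs `≤ 8π²` (`exists_twist_energy_le`) and moves the whole condensate to
pair momentum `∓4π/L ê₁` (`re_pairFieldAt_twist_ge`: `S ≥ aL²/2 − 32π²`).  Reading for provers: "approximate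
ground state" stubs (variational closeness, energy-density asymptotics in `U` of any precision, infinite-volume
ground-state/KMS characterisations — all blind to `O(1)` out of `O(L²)`) are dead on arrival; the exact
eigen-equation must enter with `O(1)` teeth (tower-of-states / phase rigidity at wavelength `L`).
Lieb–Schultz–Mattis (1961); Watanabe (2019) §2.2.1. [folklore] -/
theorem noInfraredPileUp_false_nearGroundStates_of_lro (hLRO : WeakCouplingTorusLRO) :
    ¬ NoInfraredPileUpNearGroundStates :=
  not_noInfraredPileUpNearGroundStates_of_weakCouplingLRO hLRO

/-- MUTATION 3 — drop the normalisation `star (ψ L) ⬝ᵥ ψ L = 1` (ground states form a cone,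
`isGroundStateInSector_smul`; `S` is quadratic, `pairStructureFactor_smul`).  NOT refuted and not refutable
here: because `ε, L₀` may depend on the family, scaling a unit ground-state family by `c_L → ∞` only yields,
for THAT family, super-fast decay `T_{ε(c)}(ψ_L) ≤ η L²/|c_L|²` beyond `L₀(c)` in a `c`-dependent window —
an absurdly strong vanishing law on exact ground states, but one nobody can contradict without controlling
them (contrast the sibling 1089, where `ε₀, L₀` are uniform and the mutation forces `Δ_d(m)ψ = 0` exactly,
`pairFieldAt_mulVec_eq_zero_of_withoutNormalisation`).  Recorded as the precise consequence. [folklore] -/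
theorem withoutNormalisation_consequence
    (h : ∀ δ ∈ Set.Ioo (0:ℝ) (1 / 2), ∃ U₁ : ℝ, 0 < U₁ ∧ ∀ U ∈ Set.Ioo (0:ℝ) U₁,
      ∀ (N : ℕ → ℕ) (ψ : ∀ L, Fock (Orb (FermionTorus 2 L))),
        (∀ L, Even L → N L = 2 * ⌊(1 - δ) * (L : ℝ) ^ 2 / 2⌋₊ ∧
            IsGroundStateInSector (hubbardTorus 2 L 1 U) (N L) 0 (ψ L)) →
          ∀ η : ℝ, 0 < η → ∃ ε : ℝ, 0 < ε ∧ ∃ L₀ : ℕ, ∀ (L : ℕ) [NeZero L], Even L → L₀ ≤ L →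
            (∑ m : Fin 2 → ZMod L, if m ≠ 0 ∧ momentumNormSq L m ≤ ε ^ 2 then
                pairStructureFactor dWaveFormFactor L (ψ L) m else 0) ≤ η * (L : ℝ) ^ 2) :
    ∀ δ ∈ Set.Ioo (0:ℝ) (1 / 2), ∃ U₁ : ℝ, 0 < U₁ ∧ ∀ U ∈ Set.Ioo (0:ℝ) U₁,
      ∀ (N : ℕ → ℕ) (ψ : ∀ L, Fock (Orb (FermionTorus 2 L))) (c : ℕ → ℝ), (∀ L, 0 < c L) →
        (∀ L, Even L → N L = 2 * ⌊(1 - δ) * (L : ℝ) ^ 2 / 2⌋₊ ∧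
            IsGroundStateInSector (hubbardTorus 2 L 1 U) (N L) 0 (ψ L)) →
          ∀ η : ℝ, 0 < η → ∃ ε : ℝ, 0 < ε ∧ ∃ L₀ : ℕ, ∀ (L : ℕ) [NeZero L], Even L → L₀ ≤ L →
            (∑ m : Fin 2 → ZMod L, if m ≠ 0 ∧ momentumNormSq L m ≤ ε ^ 2 then
                pairStructureFactor dWaveFormFactor L (ψ L) m else 0) ≤ η * (L : ℝ) ^ 2 / (c L) ^ 2 := by
  intro δ hδ
  obtain ⟨U₁, hU₁, h'⟩ := h δ hδ
  refine ⟨U₁, hU₁, fun U hU N ψ c hc hadm η hη => ?_⟩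
  -- apply the mutated statement to the rescaled ground-state family `c_L • ψ_L`
  have hadm' : ∀ L, Even L → N L = 2 * ⌊(1 - δ) * (L : ℝ) ^ 2 / 2⌋₊ ∧
      IsGroundStateInSector (hubbardTorus 2 L 1 U) (N L) 0 ((fun L => ((c L : ℝ) : ℂ) • ψ L) L) :=
    fun L hE => ⟨(hadm L hE).1, Literature.Barriers.HubbardSuperconductivity.isGroundStateInSector_smul
      (hadm L hE).2 (by exact_mod_cast (hc L).ne')⟩
  obtain ⟨ε, hε, L₀, hL⟩ := h' U hU N (fun L => ((c L : ℝ) : ℂ) • ψ L) hadm' η hη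
  refine ⟨ε, hε, L₀, fun L _ hE hL₀ => ?_⟩
  have hw := hL L hE hL₀
  have hcL := hc L
  have hc2 : (0 : ℝ) < (c L) ^ 2 := by positivity
  rw [le_div_iff₀ hc2]
  have hscale : ∀ m : Fin 2 → ZMod L,
      pairStructureFactor dWaveFormFactor L (((c L : ℝ) : ℂ) • ψ L) m =
        (c L) ^ 2 * pairStructureFactor dWaveFormFactor L (ψ L) m := by
    intro m
    rw [pairStructureFactor_smul, Complex.norm_real, Real.norm_eq_abs, sq_abs]
  have hsum : (∑ m : Fin 2 → ZMod L, if m ≠ 0 ∧ momentumNormSq L m ≤ ε ^ 2 then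
      pairStructureFactor dWaveFormFactor L (((c L : ℝ) : ℂ) • ψ L) m else 0) =
      (c L) ^ 2 * (∑ m : Fin 2 → ZMod L, if m ≠ 0 ∧ momentumNormSq L m ≤ ε ^ 2 then
        pairStructureFactor dWaveFormFactor L (ψ L) m else 0) := by
    rw [Finset.mul_sum]
    refine Finset.sum_congr rfl fun m _ => ?_
    split_ifs
    · exact hscale m
    · exact (mul_zero _).symm
  rw [hsum] at hw
  linarith

/-! ## §3 Load-bearing: the momentum cut `m ≠ 0` -/

/-- MUTATION 4 — admit the zero mode into the window (drop `m ≠ 0` from the summand's guard). [folklore] -/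
def NoInfraredPileUpWithZeroMode : Prop :=
  ∀ δ ∈ Set.Ioo (0:ℝ) (1 / 2), ∃ U₁ : ℝ, 0 < U₁ ∧ ∀ U ∈ Set.Ioo (0:ℝ) U₁,
    ∀ (N : ℕ → ℕ) (ψ : ∀ L, Fock (Orb (FermionTorus 2 L))),
      (∀ L, Even L → N L = 2 * ⌊(1 - δ) * (L : ℝ) ^ 2 / 2⌋₊ ∧ star (ψ L) ⬝ᵥ ψ L = 1 ∧
          IsGroundStateInSector (hubbardTorus 2 L 1 U) (N L) 0 (ψ L)) →
        ∀ η : ℝ, 0 < η → ∃ ε : ℝ, 0 < ε ∧ ∃ L₀ : ℕ, ∀ (L : ℕ) [NeZero L], Even L → L₀ ≤ L →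
          (∑ m : Fin 2 → ZMod L, if momentumNormSq L m ≤ ε ^ 2 then
              pairStructureFactor dWaveFormFactor L (ψ L) m else 0) ≤ η * (L : ℝ) ^ 2

/-- Mutation 4 is a STRENGTHENING of the crux (the window only grows). [folklore] -/
theorem noInfraredPileUp_of_withZeroMode (h : NoInfraredPileUpWithZeroMode) : NoInfraredPileUp := by
  intro δ hδ
  obtain ⟨U₁, hU₁, h'⟩ := h δ hδ
  refine ⟨U₁, hU₁, fun U hU N ψ hadm η hη => ?_⟩
  obtain ⟨ε, hε, L₀, hL⟩ := h' U hU N ψ hadm η hη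
  refine ⟨ε, hε, L₀, fun L _ hE hL₀ => le_trans (Finset.sum_le_sum fun m _ => ?_) (hL L hE hL₀)⟩
  by_cases hm : m ≠ 0 ∧ momentumNormSq L m ≤ ε ^ 2
  · rw [if_pos hm, if_pos hm.2]
  · rw [if_neg hm]
    split_ifs
    · exact pairStructureFactor_nonneg _ _ _ _
    · exact le_rfl

/-- **The cut `m ≠ 0` is load-bearing FOR THE ROUTE** (LANDED, p145822): the rank-2 crux REFUTES Mutation 4,
`NoNormalLimitState → ¬ NoInfraredPileUpWithZeroMode` — with the zero mode in the window, `S_L(0) ≤ ηL²`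
eventually for every `η`, so the LRO sequence `S_{2k}(0)/(2k)²` of every admissible family tends to `0`, while
`NoNormalLimitState` + the landed exchange lemma (18535) + the implied original tightness give
`liminf_k LRO_{2k} > 0` for the same family (families exist by choice over unit sector ground states).
Reading: the crux is an infrared statement AROUND the condensate, never ON it; any envelope a proof produces
must be allowed to blow up at `q = 0` (where the route wants `Θ(L²)`), so bounds on `Σ_{|q| ≤ ε} S` through
quantities continuous at `q = 0` (pair number in a momentum ball, `ρ₂`-eigenvalue sums, uniform
susceptibilities) cannot serve this route. Scalapino (1995) §2; Kennedy–Lieb–Shastry (1988). [folklore] -/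
theorem noInfraredPileUp_false_withZeroMode_of_noNormalLimitState (h1 : NoNormalLimitState) :
    ¬ NoInfraredPileUpWithZeroMode :=
  not_noInfraredPileUpWithZeroMode_of_noNormalLimitState h1

/-! ## §4 Normal form (uniform in the state) and natural strengthenings -/

/-- The STATE-UNIFORM form: `ε, L₀` depend on `(δ, U, η)` only and the bound holds for every unit
`(2⌊(1-δ)L²/2⌋, 0)`-sector ground state of every large even torus (no families at all). [folklore] -/
def NoInfraredPileUpUniform : Prop :=
  ∀ δ ∈ Set.Ioo (0:ℝ) (1 / 2), ∃ U₁ : ℝ, 0 < U₁ ∧ ∀ U ∈ Set.Ioo (0:ℝ) U₁,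
    ∀ η : ℝ, 0 < η → ∃ ε : ℝ, 0 < ε ∧ ∃ L₀ : ℕ, ∀ (L : ℕ) [NeZero L], Even L → L₀ ≤ L →
      ∀ ψ : Fock (Orb (FermionTorus 2 L)), star ψ ⬝ᵥ ψ = 1 →
        IsGroundStateInSector (hubbardTorus 2 L 1 U) (2 * ⌊(1 - δ) * (L : ℝ) ^ 2 / 2⌋₊) 0 ψ →
          (∑ m : Fin 2 → ZMod L, if m ≠ 0 ∧ momentumNormSq L m ≤ ε ^ 2 then
              pairStructureFactor dWaveFormFactor L ψ m else 0) ≤ η * (L : ℝ) ^ 2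

/-- **The crux is EQUIVALENT to its state-uniform form** (`→` LANDED as `noInfraredPileUp_uniform`, p145826,
diagonal-family argument: admissibility is a product condition over the sides; `←` is instantiation).
Consequences: (i) the refutation surface is ONE `η` and, per `(ε, L₀)`, ONE bad unit sector ground state on ONE
even torus — no coherent sequence, no limit state needed; (ii) provers gain nothing from `ε = ε(ψ)`: the
content is a bound uniform over the ground eigenspaces of all large even tori at fixed `(U, δ)`; (iii) the
strategist's remark "per-family/uniform-in-ψ equivalence at fixed `(U,δ)` is free" is now kernel-checked.
[folklore] -/
theorem noInfraredPileUp_iff_uniform : NoInfraredPileUp ↔ NoInfraredPileUpUniform := by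
  refine ⟨noInfraredPileUp_uniform, fun h δ hδ => ?_⟩
  obtain ⟨U₁, hU₁, h'⟩ := h δ hδ
  refine ⟨U₁, hU₁, fun U hU N ψ hadm η hη => ?_⟩
  obtain ⟨ε, hε, L₀, hL⟩ := h' U hU η hη
  refine ⟨ε, hε, L₀, fun L _ hE hL₀ => ?_⟩
  have h2 := (hadm L hE).2.2
  rw [(hadm L hE).1] at h2
  exact hL L hE hL₀ (ψ L) (hadm L hE).2.1 h2

/-- STRENGTHENING S⁺₂ (strategist) — a UNIFORM FLAT WINDOW, `S_ψ(m) ≤ C` for every nonzero mode of every unit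
sector ground state at weak coupling.  Implies the crux with room (`T_ε ≤ C·#{0<|q_m|≤ε} ≈ Cε²L²/4π`).  NOT
refutable here (exact ground states again) but FALSE IN KIND twice over: (i) wherever a ground state has
`d`-wave LRO with a linearly dispersing phase mode (Goldstone shape `S(q_min) ≈ m²c_s L/(4πρ_s) ∝ L`; the
sibling's `CεL²` rate is the sharp one); (ii) wherever uniform `d`-wave order COEXISTS with any density wave of
wave vector `Q ≠ 0` (incommensurate SDW/CDW coexistence is the fRG picture at weak-to-moderate coupling,
Qin–Schäfer–Andergassen–Corboz–Gull, Annu. Rev. CMP 13 (2022) §4.1): the induced pair-density-wave satellite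
has `S(Q_CDW) = Θ(L²)` at a FIXED nonzero momentum — fatal for any flat/pointwise envelope, HARMLESS for the
soft crux (take `ε < |Q_CDW|`; only satellites with `|Q_L| → 0` bite).  True in pair-disordered phases, where
the crux is automatic anyway (§5).  Provers should NOT aim at pointwise envelopes `S_ψ(m) ≤ f(q_m)` with `f`
locally bounded on `q ≠ 0` either — the same satellite kills them; the crux needs only the MEASURE statement.
Pitaevskii–Stringari, J. Low Temp. Phys. 85 (1991) 377; Kennedy–Lieb–Shastry (1988). [folklore] -/
def UniformFlatWindow : Prop :=
  ∀ δ ∈ Set.Ioo (0:ℝ) (1 / 2), ∃ U₁ : ℝ, 0 < U₁ ∧ ∃ C : ℝ, ∀ U ∈ Set.Ioo (0:ℝ) U₁,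
    ∃ L₀ : ℕ, ∀ (L : ℕ) [NeZero L], Even L → L₀ ≤ L →
      ∀ ψ : Fock (Orb (FermionTorus 2 L)), star ψ ⬝ᵥ ψ = 1 →
        IsGroundStateInSector (hubbardTorus 2 L 1 U) (2 * ⌊(1 - δ) * (L : ℝ) ^ 2 / 2⌋₊) 0 ψ →
          ∀ m : Fin 2 → ZMod L, m ≠ 0 → pairStructureFactor dWaveFormFactor L ψ m ≤ C

/-- STRENGTHENING S⁺₅ — window uniform in the COUPLING too (`∀ η ∃ ε ∀ U < U₁ …`).  Plausible (the expected
pile-up scale `m(U)²c_s ε/(4πρ_s)` vanishes as `U → 0`), strictly harder, not refutable here; recorded so that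
nobody mistakes it for the crux. [folklore] -/
def CouplingUniformWindow : Prop :=
  ∀ δ ∈ Set.Ioo (0:ℝ) (1 / 2), ∃ U₁ : ℝ, 0 < U₁ ∧ ∀ η : ℝ, 0 < η → ∃ ε : ℝ, 0 < ε ∧
    ∀ U ∈ Set.Ioo (0:ℝ) U₁, ∃ L₀ : ℕ, ∀ (L : ℕ) [NeZero L], Even L → L₀ ≤ L →
      ∀ ψ : Fock (Orb (FermionTorus 2 L)), star ψ ⬝ᵥ ψ = 1 →
        IsGroundStateInSector (hubbardTorus 2 L 1 U) (2 * ⌊(1 - δ) * (L : ℝ) ^ 2 / 2⌋₊) 0 ψ →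
          (∑ m : Fin 2 → ZMod L, if m ≠ 0 ∧ momentumNormSq L m ≤ ε ^ 2 then
              pairStructureFactor dWaveFormFactor L ψ m else 0) ≤ η * (L : ℝ) ^ 2

/-- `CouplingUniformWindow → NoInfraredPileUpUniform` (swap `∀ U ∃ ε` ← `∃ ε ∀ U`). [folklore] -/
theorem uniform_of_couplingUniform (h : CouplingUniformWindow) : NoInfraredPileUpUniform := by
  intro δ hδ
  obtain ⟨U₁, hU₁, h'⟩ := h δ hδ
  refine ⟨U₁, hU₁, fun U hU η hη => ?_⟩
  obtain ⟨ε, hε, h''⟩ := h' η hη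
  obtain ⟨L₀, hL⟩ := h'' U hU
  exact ⟨ε, hε, L₀, hL⟩

/-! ## §5 Why it resists: a kill is an infinite-volume condensation theorem -/

/-- THE TYPED OBSTRUCTION (strategist `StrategistSketch.lean` §N, made a theorem this cycle:
`pileUpForcesLimitAtom`, LANDED p146003; model-free harmonic analysis — Fejér majorant
`windowSum_le_fejerMajorant` + tent identity + `tightnessExchange_boxSum_eq` + the diagonal compactness of the
landed exchange lemma): a family normalised at even sides whose windows are NOT tight has, along some
strictly increasing sequence of even sides, a pointwise limit of its translation-averaged `d`-wave pair
correlations with a STRICTLY POSITIVE condensate atom (`≥ η/16`). [folklore] -/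
def PileUpForcesLimitAtom : Prop :=
  ∀ (ψ : ∀ L, Fock (Orb (FermionTorus 2 L))), (∀ L, Even L → star (ψ L) ⬝ᵥ ψ L = 1) →
    ¬ (∀ η : ℝ, 0 < η → ∃ ε : ℝ, 0 < ε ∧ ∃ L₀ : ℕ, ∀ (L : ℕ) [NeZero L], Even L → L₀ ≤ L →
        (∑ m : Fin 2 → ZMod L, if m ≠ 0 ∧ momentumNormSq L m ≤ ε ^ 2 then
            pairStructureFactor dWaveFormFactor L (ψ L) m else 0) ≤ η * (L : ℝ) ^ 2) →
      ∃ (Ls : ℕ → ℕ) (C : Site 2 → ℝ), StrictMono Ls ∧ (∀ j, Even (Ls j)) ∧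
        (∀ x : Site 2, Tendsto (fun j : ℕ => (∑ y ∈ halfOpenBox 2 (Ls j),
            torusPullback (pairFieldCorr dWaveFormFactor ψ) (Ls j) (x + y) y) / ((Ls j : ℕ) : ℝ) ^ 2)
          atTop (𝓝 (C x))) ∧
        0 < liminf (fun R : ℕ => (∑ x ∈ halfOpenBox 2 R, ∑ y ∈ halfOpenBox 2 R, C (x - y)) /
          ((R : ℕ) : ℝ) ^ 4) atTop

/-! The three theorems below are VERBATIM the landed `…/Negative/PileUpForcesLimitAtom.lean` (p146003),
inlined so that this work file elaborates before the check farm has built that module (the import-based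
version, also importing `…/Negative/KillIsCondensation.lean`, is kept in the disprover's folder as
`DisproofImports.lean` and replaces this file at the next update). -/

/-- **A bad window forces mesoscopic block pair order of the translation-averaged correlation** (finite
side `n + 1`, block scale `0 < R`, `2R ≤ n+1`, window `εR ≤ 1`): if `T_ε(ψ_{n+1}) > η (n+1)²` then
`R⁻⁴ Σ_{x,y ∈ [0,R)²} C_{n+1}(x − y) > η/16`.  Chain: box sums = `L⁻² Σ_a‖B_aψ‖²`
(`tightnessExchange_boxSum_eq`) `= L⁻² R² T_R` (tent identity) and `T_R/R² ≥ T_ε/16 + S(0)` (Fejér majorant).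
Kennedy–Lieb–Shastry, PRL 61 (1988) 2582; Stein–Shakarchi Ch. 2. [folklore] -/
theorem boxAvg_corrAvg_gt_of_badWindow (ψ : ∀ L, Fock (Orb (FermionTorus 2 L))) (n R : ℕ) (hR : 0 < R)
    (hRL : 2 * R ≤ n + 1) {ε η : ℝ} (hε : 0 < ε) (hεR : ε * R ≤ 1)
    (hbad : η * ((n + 1 : ℕ) : ℝ) ^ 2 < ∑ m : Fin 2 → ZMod (n + 1),
        if m ≠ 0 ∧ momentumNormSq (n + 1) m ≤ ε ^ 2 then
          pairStructureFactor dWaveFormFactor (n + 1) (ψ (n + 1)) m else 0) :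
    η / 16 < (∑ x ∈ halfOpenBox 2 R, ∑ y ∈ halfOpenBox 2 R,
        (∑ w ∈ halfOpenBox 2 (n + 1),
          torusPullback (pairFieldCorr dWaveFormFactor ψ) (n + 1) (x - y + w) w) /
            ((n + 1 : ℕ) : ℝ) ^ 2) / (R : ℝ) ^ 4 := by
  rw [tightnessExchange_boxSum_eq,
    FunctionFieldCertificateAssembly.re_sum_star_blockMulVec_dotProduct_eq R hR hRL
      (localPair dWaveFormFactor (n + 1)) (ψ (n + 1))]
  have hmaj := WindowInfraredBound.windowSum_le_fejerMajorant dWaveFormFactor (n + 1) R hR hRL ε hε hεR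
    (ψ (n + 1))
  have hS0 := pairStructureFactor_nonneg dWaveFormFactor (n + 1) (ψ (n + 1)) 0
  set T : ℝ := ∑ x : TorusSite 2 (n + 1), ∑ y : TorusSite 2 (n + 1),
      (∏ i : Fin 2, max 0 (1 - |(((y i - x i).valMinAbs : ℤ) : ℝ)| / (R : ℝ))) *
        (star (localPair dWaveFormFactor (n + 1) x *ᵥ ψ (n + 1)) ⬝ᵥ
          (localPair dWaveFormFactor (n + 1) y *ᵥ ψ (n + 1))).re with hT
  have hRpos : (0 : ℝ) < R := Nat.cast_pos.2 hR
  have hLpos : (0 : ℝ) < ((n + 1 : ℕ) : ℝ) := by positivity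
  have hR2 : (0 : ℝ) < (R : ℝ) ^ 2 := by positivity
  -- `T / R² ≥ T_ε / 16 + S(0) > η (n+1)² / 16`
  have h1 : η * ((n + 1 : ℕ) : ℝ) ^ 2 / 16 < T / (R : ℝ) ^ 2 := by linarith [hmaj, hbad, hS0]
  have h2 : (R : ℝ) ^ 2 * T / ((n + 1 : ℕ) : ℝ) ^ 2 / (R : ℝ) ^ 4 =
      T / (R : ℝ) ^ 2 / ((n + 1 : ℕ) : ℝ) ^ 2 := by
    field_simp
  rw [h2, lt_div_iff₀ (by positivity)]
  linarith

/-- **PILE-UP FORCES A LIMIT ATOM.**  For any family of torus Fock vectors normalised at the even sides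
whose small-momentum windows are NOT tight, some strictly increasing sequence of even sides carries the
translation-averaged `d`-wave pair correlations pointwise to a limit with a strictly positive condensate
atom.  Hence `¬ NoInfraredPileUp` supplies, at some `δ` and in every coupling interval `(0, U₁)`, an
admissible Hubbard ground-state family with a torus-limit having `d_{x²−y²}` ODLRO: a kill of the crux is
an infinite-volume weak-coupling pair-condensation THEOREM. Kennedy–Lieb–Shastry, PRL 61 (1988) 2582;
Fröhlich–Simon–Spencer, CMP 50 (1976) 79, §3; Friedli–Velenik (2017) §3.7.2. [folklore] -/
theorem pileUpForcesLimitAtom (ψ : ∀ L, Fock (Orb (FermionTorus 2 L)))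
    (hnorm : ∀ L, Even L → star (ψ L) ⬝ᵥ ψ L = 1)
    (hnt : ¬ (∀ η : ℝ, 0 < η → ∃ ε : ℝ, 0 < ε ∧ ∃ L₀ : ℕ, ∀ (L : ℕ) [NeZero L], Even L → L₀ ≤ L →
        (∑ m : Fin 2 → ZMod L, if m ≠ 0 ∧ momentumNormSq L m ≤ ε ^ 2 then
            pairStructureFactor dWaveFormFactor L (ψ L) m else 0) ≤ η * (L : ℝ) ^ 2)) :
    ∃ (Ls : ℕ → ℕ) (C : Site 2 → ℝ), StrictMono Ls ∧ (∀ j, Even (Ls j)) ∧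
      (∀ x : Site 2, Tendsto (fun j : ℕ => (∑ y ∈ halfOpenBox 2 (Ls j),
          torusPullback (pairFieldCorr dWaveFormFactor ψ) (Ls j) (x + y) y) / ((Ls j : ℕ) : ℝ) ^ 2)
        atTop (𝓝 (C x))) ∧
      0 < liminf (fun R : ℕ => (∑ x ∈ halfOpenBox 2 R, ∑ y ∈ halfOpenBox 2 R, C (x - y)) /
        ((R : ℕ) : ℝ) ^ 4) atTop := by
  push Not at hnt
  obtain ⟨η, hη, hbad⟩ := hnt
  -- the constant `C_d²`
  obtain ⟨B, hB⟩ : ∃ B : ℝ, B = (∑ e ∈ insert (0 : Site 2) unitSteps,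
      ‖((dWaveFormFactor e / Real.sqrt 2 : ℝ) : ℂ)‖ * 2) ^ 2 := ⟨_, rfl⟩
  have hB0 : 0 ≤ B := by rw [hB]; positivity
  -- the translation-averaged pair correlations
  obtain ⟨Cavg, hCavg⟩ : ∃ Cavg : ℕ → Site 2 → ℝ, ∀ L x, Cavg L x =
      (∑ y ∈ halfOpenBox 2 L, torusPullback (pairFieldCorr dWaveFormFactor ψ) L (x + y) y) /
        ((L : ℕ) : ℝ) ^ 2 := ⟨_, fun _ _ => rfl⟩
  -- Step 1: bad sides for the windows `1/(k+1)`
  have hkpos : ∀ k : ℕ, (0 : ℝ) < 1 / ((k : ℝ) + 1) := fun k => by positivity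
  choose side inst hEven hle hT using fun (k : ℕ) (L₀ : ℕ) => hbad (1 / ((k : ℝ) + 1)) (hkpos k) L₀
  obtain ⟨s, hs0, hs⟩ : ∃ s : ℕ → ℕ, s 0 = side 0 2 ∧ ∀ k, s (k + 1) = side (k + 1) (s k + 2 * k + 4) :=
    ⟨fun k => Nat.rec (side 0 2) (fun k sk => side (k + 1) (sk + 2 * k + 4)) k, rfl, fun _ => rfl⟩
  obtain ⟨pre, hpre0, hpre⟩ : ∃ pre : ℕ → ℕ, pre 0 = 2 ∧ ∀ k, pre (k + 1) = s k + 2 * k + 4 :=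
    ⟨fun k => Nat.rec 2 (fun k _ => s k + 2 * k + 4) k, rfl, fun _ => rfl⟩
  have hspre : ∀ k, s k = side k (pre k) := by
    intro k
    cases k with
    | zero => rw [hs0, hpre0]
    | succ k => rw [hs, hpre]
  have hpre_ge : ∀ k, 2 * (k + 1) ≤ pre k := by
    intro k
    cases k with
    | zero => rw [hpre0]
    | succ k => rw [hpre]; omega
  have hs_ge : ∀ k, 2 * (k + 1) ≤ s k := fun k => by
    rw [hspre]; exact (hpre_ge k).trans (hle k (pre k))
  have hsmono : StrictMono s := by
    refine strictMono_nat_of_lt_succ fun k => ?_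
    have h1 := hle (k + 1) (s k + 2 * k + 4)
    rw [← hs] at h1
    omega
  have hs_even : ∀ k, Even (s k) := fun k => by rw [hspre]; exact hEven k (pre k)
  -- Step 2: block pair order `> η/16` at the bad side `s k`, every block scale `1 ≤ R ≤ k + 1`
  have hside : ∀ (L : ℕ) [NeZero L] (k R : ℕ), 0 < R → 2 * R ≤ L → R ≤ k + 1 →
      η * (L : ℝ) ^ 2 < (∑ m : Fin 2 → ZMod L, if m ≠ 0 ∧ momentumNormSq L m ≤ (1 / ((k : ℝ) + 1)) ^ 2 then
          pairStructureFactor dWaveFormFactor L (ψ L) m else 0) →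
        η / 16 < (∑ x ∈ halfOpenBox 2 R, ∑ y ∈ halfOpenBox 2 R, Cavg L (x - y)) / ((R : ℕ) : ℝ) ^ 4 := by
    intro L _ k R hR hRL hRk hTL
    obtain ⟨n, rfl⟩ : ∃ n, L = n + 1 := ⟨L - 1, by omega⟩
    have hεR : 1 / ((k : ℝ) + 1) * R ≤ 1 := by
      rw [div_mul_eq_mul_div, one_mul, div_le_one (by positivity)]
      exact_mod_cast hRk
    simp only [hCavg]
    exact boxAvg_corrAvg_gt_of_badWindow ψ n R hR hRL (hkpos k) hεR hTL
  have hblock : ∀ k R : ℕ, 0 < R → R ≤ k + 1 →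
      η / 16 < (∑ x ∈ halfOpenBox 2 R, ∑ y ∈ halfOpenBox 2 R, Cavg (s k) (x - y)) / ((R : ℕ) : ℝ) ^ 4 := by
    intro k R hR hRk
    rw [hspre k]
    have h2R : 2 * R ≤ side k (pre k) := by
      have h1 := hpre_ge k
      have h2 := hle k (pre k)
      omega
    exact @hside (side k (pre k)) (inst k (pre k)) k R hR h2R hRk (hT k (pre k))
  -- Step 3: diagonal compactness — a pointwise convergent subsequence of `C_{s k}`
  have hCB : ∀ k x, |Cavg (s k) x| ≤ B := fun k x => by
    rw [hCavg, hB]; exact tightnessExchange_abs_corrAvg_le ψ _ (hnorm _ (hs_even k)) x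
  obtain ⟨K, hK⟩ : ∃ K : Set (Site 2 → ℝ), K = Set.pi Set.univ fun _ => Set.Icc (-B) B := ⟨_, rfl⟩
  have hKc : IsCompact K := hK ▸ isCompact_univ_pi fun _ => isCompact_Icc
  have hmem : ∀ k, (fun x => Cavg (s k) x) ∈ K := fun k =>
    hK ▸ Set.mem_univ_pi.2 fun x => abs_le.1 (hCB k x)
  obtain ⟨C, hCK, φ, hφ, hconv⟩ := hKc.tendsto_subseq hmem
  rw [hK] at hCK
  have hCbd : ∀ x, |C x| ≤ B := fun x => abs_le.2 (Set.mem_univ_pi.1 hCK x)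
  -- the subsequence of sides
  obtain ⟨Ls, hLs⟩ : ∃ Ls : ℕ → ℕ, ∀ j, Ls j = s (φ j) := ⟨_, fun _ => rfl⟩
  have hLs_mono : StrictMono Ls := fun a b hab => by
    rw [hLs, hLs]; exact hsmono (hφ hab)
  have hLs_even : ∀ j, Even (Ls j) := fun j => hLs j ▸ hs_even _
  have hLs_conv : ∀ x : Site 2, Tendsto (fun j => Cavg (Ls j) x) atTop (𝓝 (C x)) := fun x =>
    (tendsto_pi_nhds.1 hconv x).congr fun j => by simp only [Function.comp_apply, hLs]
  -- Step 4: the atom of the limit is at least `η/16`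
  obtain ⟨b, hb⟩ : ∃ b : ℕ → ℝ, ∀ R, b R = (∑ x ∈ halfOpenBox 2 R, ∑ y ∈ halfOpenBox 2 R,
      C (x - y)) / ((R : ℕ) : ℝ) ^ 4 := ⟨_, fun _ => rfl⟩
  have hbR : ∀ R : ℕ, 0 < R → η / 16 ≤ b R := by
    intro R hR
    have hbj : Tendsto (fun j => (∑ x ∈ halfOpenBox 2 R, ∑ y ∈ halfOpenBox 2 R,
        Cavg (Ls j) (x - y)) / ((R : ℕ) : ℝ) ^ 4) atTop (𝓝 (b R)) := by
      rw [hb]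
      exact (tendsto_finsetSum _ fun x _ => tendsto_finsetSum _ fun y _ =>
        hLs_conv (x - y)).div_const _
    refine ge_of_tendsto hbj (eventually_atTop.2 ⟨R, fun j hj => ?_⟩)
    have hφj : j ≤ φ j := hφ.id_le j
    rw [hLs]
    exact (hblock (φ j) R hR (by omega)).le
  have hb_up : ∀ R, b R ≤ B := by
    intro R
    have habs : |b R| ≤ B := by
      rw [hb, abs_div, abs_of_nonneg (by positivity : (0 : ℝ) ≤ ((R : ℕ) : ℝ) ^ 4)]
      rcases Nat.eq_zero_or_pos R with rfl | hRpos
      · simpa using hB0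
      · rw [div_le_iff₀ (by positivity)]
        calc |∑ x ∈ halfOpenBox 2 R, ∑ y ∈ halfOpenBox 2 R, C (x - y)|
            ≤ ∑ x ∈ halfOpenBox 2 R, |∑ y ∈ halfOpenBox 2 R, C (x - y)| :=
              Finset.abs_sum_le_sum_abs _ _
          _ ≤ ∑ x ∈ halfOpenBox 2 R, ∑ y ∈ halfOpenBox 2 R, |C (x - y)| :=
              Finset.sum_le_sum fun x _ => Finset.abs_sum_le_sum_abs _ _
          _ ≤ ∑ x ∈ halfOpenBox 2 R, ∑ y ∈ halfOpenBox 2 R, B :=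
              Finset.sum_le_sum fun x _ => Finset.sum_le_sum fun y _ => hCbd _
          _ = B * ((R : ℕ) : ℝ) ^ 4 := by
              rw [Finset.sum_const, Finset.sum_const, card_halfOpenBox, smul_smul, nsmul_eq_mul]
              push_cast
              ring
    exact (abs_le.1 habs).2
  have hlim : η / 16 ≤ liminf b atTop :=
    le_liminf_of_le (isCoboundedUnder_ge_of_le atTop hb_up)
      (eventually_atTop.2 ⟨1, fun R hR => hbR R hR⟩)
  refine ⟨Ls, C, hLs_mono, hLs_even, fun x => ?_, ?_⟩
  · simpa only [hCavg] using hLs_conv x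
  · have hfun : (fun R : ℕ => (∑ x ∈ halfOpenBox 2 R, ∑ y ∈ halfOpenBox 2 R, C (x - y)) /
        ((R : ℕ) : ℝ) ^ 4) = b := funext fun R => (hb R).symm
    rw [hfun]
    linarith

/-- **ALL-NORMAL ⇒ TIGHT** (contrapositive reading, pure logic from `pileUpForcesLimitAtom`): if EVERY
pointwise torus-limit (along strictly increasing even sides) of the translation-averaged `d`-wave pair
correlations of a family normalised at even sides has condensate atom `≤ 0`, then the family's small-momentum
windows are tight.  So the crux `NoInfraredPileUp` is AUTOMATIC for every admissible family all of whose
limits are normal — its content lives exactly where the route is alive (ordered limit states, `η` below the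
atom), behind the twist wall of `…/Negative/NearGroundStates.lean`. [folklore] -/
theorem allNormalImpliesTight (ψ : ∀ L, Fock (Orb (FermionTorus 2 L)))
    (hnorm : ∀ L, Even L → star (ψ L) ⬝ᵥ ψ L = 1)
    (hnormal : ∀ (Ls : ℕ → ℕ) (C : Site 2 → ℝ), StrictMono Ls → (∀ j, Even (Ls j)) →
      (∀ x : Site 2, Tendsto (fun j : ℕ => (∑ y ∈ halfOpenBox 2 (Ls j),
          torusPullback (pairFieldCorr dWaveFormFactor ψ) (Ls j) (x + y) y) / ((Ls j : ℕ) : ℝ) ^ 2)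
        atTop (𝓝 (C x))) →
        liminf (fun R : ℕ => (∑ x ∈ halfOpenBox 2 R, ∑ y ∈ halfOpenBox 2 R, C (x - y)) /
          ((R : ℕ) : ℝ) ^ 4) atTop ≤ 0) :
    ∀ η : ℝ, 0 < η → ∃ ε : ℝ, 0 < ε ∧ ∃ L₀ : ℕ, ∀ (L : ℕ) [NeZero L], Even L → L₀ ≤ L →
      (∑ m : Fin 2 → ZMod L, if m ≠ 0 ∧ momentumNormSq L m ≤ ε ^ 2 then
          pairStructureFactor dWaveFormFactor L (ψ L) m else 0) ≤ η * (L : ℝ) ^ 2 := by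
  by_contra hnt
  obtain ⟨Ls, C, hLs, hev, hconv, hatom⟩ := pileUpForcesLimitAtom ψ hnorm hnt
  exact absurd (hnormal Ls C hLs hev hconv) (not_le.2 hatom)

/-- `PileUpForcesLimitAtom` holds (LANDED: `…/Negative/PileUpForcesLimitAtom.lean`). [folklore] -/
theorem pileUpForcesLimitAtom_holds : PileUpForcesLimitAtom :=
  fun ψ hnorm hnt => pileUpForcesLimitAtom ψ hnorm hnt

/-- ALL-NORMAL ⇒ TIGHT (LANDED as `allNormalImpliesTight`): a family normalised at even sides all of whose
torus-limits have atom `≤ 0` has tight windows — the crux is AUTOMATIC wherever the rank-2 crux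
`NoNormalLimitState` fails totally, and has content exactly where the route is alive. [folklore] -/
def AllNormalImpliesTight : Prop :=
  ∀ (ψ : ∀ L, Fock (Orb (FermionTorus 2 L))), (∀ L, Even L → star (ψ L) ⬝ᵥ ψ L = 1) →
    (∀ (Ls : ℕ → ℕ) (C : Site 2 → ℝ), StrictMono Ls → (∀ j, Even (Ls j)) →
        (∀ x : Site 2, Tendsto (fun j : ℕ => (∑ y ∈ halfOpenBox 2 (Ls j),
            torusPullback (pairFieldCorr dWaveFormFactor ψ) (Ls j) (x + y) y) / ((Ls j : ℕ) : ℝ) ^ 2)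
          atTop (𝓝 (C x))) →
          liminf (fun R : ℕ => (∑ x ∈ halfOpenBox 2 R, ∑ y ∈ halfOpenBox 2 R, C (x - y)) /
            ((R : ℕ) : ℝ) ^ 4) atTop ≤ 0) →
      ∀ η : ℝ, 0 < η → ∃ ε : ℝ, 0 < ε ∧ ∃ L₀ : ℕ, ∀ (L : ℕ) [NeZero L], Even L → L₀ ≤ L →
        (∑ m : Fin 2 → ZMod L, if m ≠ 0 ∧ momentumNormSq L m ≤ ε ^ 2 then
            pairStructureFactor dWaveFormFactor L (ψ L) m else 0) ≤ η * (L : ℝ) ^ 2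

/-- `AllNormalImpliesTight` holds (LANDED). [folklore] -/
theorem allNormalImpliesTight_holds : AllNormalImpliesTight :=
  fun ψ hnorm hnormal => allNormalImpliesTight ψ hnorm hnormal

/-- **THE PRICE OF A KILL, kernel-checked**: `¬ NoInfraredPileUp` ⇒ at some `δ ∈ (0,1/2)`, in EVERY coupling
interval `(0, U₁)`, some `U` and some ADMISSIBLE family (normalised `(2⌊(1-δ)L²/2⌋, 0)`-sector GROUND STATES of
`hubbardTorus 2 L 1 U` at every even `L`) whose translation-averaged `d`-wave pair correlations converge, along
strictly increasing even sides, to a limit with a strictly positive condensate atom — i.e. an infinite-volume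
torus-limit ground state with `d_{x²−y²}` ODLRO at arbitrarily weak coupling.  A disprover of this crux must
therefore PROVE weak-coupling pair condensation (for a cofinal family `U_n → 0`): the infinite-volume form of
the summit's conclusion.  Pure logic from `pileUpForcesLimitAtom`; LANDED verbatim as
`…/Negative/KillIsCondensation.lean` (p146252). [folklore] -/
theorem limitODLRO_of_not_noInfraredPileUp (h : ¬ NoInfraredPileUp) :
    ∃ δ ∈ Set.Ioo (0:ℝ) (1 / 2), ∀ U₁ : ℝ, 0 < U₁ → ∃ U ∈ Set.Ioo (0:ℝ) U₁,
      ∃ (N : ℕ → ℕ) (ψ : ∀ L, Fock (Orb (FermionTorus 2 L))),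
        (∀ L, Even L → N L = 2 * ⌊(1 - δ) * (L : ℝ) ^ 2 / 2⌋₊ ∧ star (ψ L) ⬝ᵥ ψ L = 1 ∧
            IsGroundStateInSector (hubbardTorus 2 L 1 U) (N L) 0 (ψ L)) ∧
        ∃ (Ls : ℕ → ℕ) (C : Site 2 → ℝ), StrictMono Ls ∧ (∀ j, Even (Ls j)) ∧
          (∀ x : Site 2, Tendsto (fun j : ℕ => (∑ y ∈ halfOpenBox 2 (Ls j),
              torusPullback (pairFieldCorr dWaveFormFactor ψ) (Ls j) (x + y) y) / ((Ls j : ℕ) : ℝ) ^ 2)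
            atTop (𝓝 (C x))) ∧
          0 < liminf (fun R : ℕ => (∑ x ∈ halfOpenBox 2 R, ∑ y ∈ halfOpenBox 2 R, C (x - y)) /
            ((R : ℕ) : ℝ) ^ 4) atTop := by
  by_contra hcon
  apply h
  intro δ hδ
  by_contra h1
  apply hcon
  refine ⟨δ, hδ, fun U₁ hU₁ => ?_⟩
  by_contra h2
  apply h1
  refine ⟨U₁, hU₁, fun U hU N ψ hadm => ?_⟩
  by_contra h3
  apply h2
  exact ⟨U, hU, N, ψ, hadm, pileUpForcesLimitAtom ψ (fun L hL => (hadm L hL).2.1) h3⟩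

/-- **First step of the obstruction, kernel-checked now**: a bad window forces MESOSCOPIC BLOCK PAIR ORDER.
If `T_ε(φ) > η L²` on a torus of side `L ≥ 2R` with `εR ≤ 1`, then the Fejér-weighted block pair coherence
exceeds the condensate by `η L² R²/16`: `T_R(φ)/R² ≥ S_φ(0) + ηL²/16` (`windowSum_le_fejerMajorant`).  So a
non-tight ground-state family is one whose pair coherence on blocks of side `R ~ 1/ε` is macroscopically
LARGER than its `k = 0` condensate — a fragmented / sliding condensate in the sense of Nozières, exactly the
object `PileUpForcesLimitAtom` turns into an infinite-volume atom. Kennedy–Lieb–Shastry (1988);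
P. Nozières, in *Bose–Einstein Condensation* (CUP 1995) pp. 15–20. [folklore] -/
theorem blockOrder_of_badWindow {L : ℕ} [NeZero L] (R : ℕ) (hR : 0 < R) (hRL : 2 * R ≤ L)
    {ε η : ℝ} (hε : 0 < ε) (hεR : ε * R ≤ 1) (φ : Fock (Orb (FermionTorus 2 L)))
    (hbad : η * (L : ℝ) ^ 2 < ∑ m : Fin 2 → ZMod L, if m ≠ 0 ∧ momentumNormSq L m ≤ ε ^ 2 then
        pairStructureFactor dWaveFormFactor L φ m else 0) :
    pairStructureFactor dWaveFormFactor L φ 0 + η * (L : ℝ) ^ 2 / 16 <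
      (∑ x : TorusSite 2 L, ∑ y : TorusSite 2 L,
        (∏ i : Fin 2, max 0 (1 - |(((y i - x i).valMinAbs : ℤ) : ℝ)| / (R : ℝ))) *
          (star (localPair dWaveFormFactor L x *ᵥ φ) ⬝ᵥ (localPair dWaveFormFactor L y *ᵥ φ)).re) /
        (R : ℝ) ^ 2 := by
  have h := Summit.HubbardSuperconductivity.HubbardSuperconductivity.Theorems.WindowInfraredBound.windowSum_le_fejerMajorant
    dWaveFormFactor L R hR hRL ε hε hεR φ
  linarith

/-- **Why it resists (cycle 1 summary).**
1. DIRECT KILL needs exact doped-Hubbard ground states on arbitrarily large tori with a sliding condensate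
   (§4 normal form); the tree constructs ground states only by compactness/choice (`szSector_groundState`),
   never with computable pair structure; no solvable point in `(0,U₁) × (0,1/2)`; `U = 0⁺` degeneracy gives
   open-shell Dicke condensates with window weight `O(1)`, not `Θ(L²)` (a Fermi shell holds `≤ O(L)` momenta).
2. SMALL MODELS: the statement is `∃ L₀`-asymptotic; ED reaches `L = 4` only (`dim ≈ 6.4·10⁷` at δ = 1/4),
   where the smallest nonzero `|q|` is `π/2` — no window.  Not run: zero refutation value (planner's "cheapest
   falsifier" needs `S(2π/L)` GROWTH in `L`, i.e. `L = 4, 6, 8, …`, beyond ED; QMC/DMRG are not evidence here).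
3. PHYSICS CANDIDATES (none rigorous, none even heuristic AT WEAK COUPLING AND FIXED δ > 0): phase separation
   with a paired component (claimed only at `U/t ≳ 8` near `δ ≲ 0.15`: Misawa–Imada PRB 90 (2014) 115137,
   contested), pair-density waves (need `t' ≠ 0`/`t-J` or spin imbalance — FFLO; at `S^z = 0` and an
   inversion-symmetric band the `q = 0` Cooper logarithm dominates every `q ≠ 0` above `1/ξ`), interaction-
   driven generalised condensation (known rigorously only in mean-field Bose models, Michoel–Verbeure 1999;
   van den Berg–Lewis–Pulé 1986 for free gases in anisotropic boxes).  The `∃ U₁(δ)` quantifier sidesteps every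
   intermediate-coupling scenario by design; the weak-coupling ground-state phase diagram at `t' = 0` is
   "fairly well understood" numerically (Qin et al. 2022 §4: uniform `d_{x²−y²}` BCS-like order for
   `0.6 ≲ n < 1`, other uniform channels at lower density, possibly coexisting incommensurate SDW) — every
   such state is tight (flat `O(1)` background + Goldstone `O(L)` at `q_min` + density-wave satellites at FIXED
   `Q ≠ 0`, excluded by `ε < |Q|`).  A kill needs a satellite with `|Q_L| → 0`, phase separation, or
   fragmentation, for which no weak-coupling mechanism is even proposed.
4. BARRIERS (`Literature/Barriers/HubbardSuperconductivity/`): `PositiveTemperatureNoPairLRO`,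
   `HohenbergMerminWagnerPairing` — `T > 0`, do not bite a ground-state statement; `LROForcesLowLyingStates` —
   its mechanism (LSM twist / tower) IS §2 Mutation 2, i.e. it bites every APPROXIMATE-ground-state proof
   strategy but says nothing about exact eigenvectors; `WeakCouplingCeiling`, `PerturbativeInvisibilityOfPairing`
   — explain why weak coupling buys no perturbative access (`L ≫ ξ = e^{c/U²}`); `GeneralizedHartreeFockNoPairing`
   — quasi-free states are flat (`S(q≠0) = O(1)`), consistent with the crux; `PureModelStripeCompetition` —
   `(U, δ) = (8, 1/8)`, outside `U < U₁`; `SignProblemNPHard`, `StrongCouplingCeiling` — irrelevant.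
   `ledger negatives`: BreathingSelfDual, KlsOrderOpenness — unrelated finite-volume identities.
5. WHAT A CYCLE 2 WOULD LAND: the strategist's per-mode kinetic ceiling `S_ψ(m) ≤ C_δ(U^{2/5}L² + 1)` for every
   sector ground state (calibration: every limit atom `≤ C U^{2/5}`, so the route runs the exchange at
   `η ≲ e^{-2c/U²}`, deep inside the twist wall; ~1.5 k lines, momentum-space CAR bookkeeping); the `U = 0`
   flat law over the WHOLE degenerate Slater ground space (`S ≤ C` uniformly: a Fermi shell holds `O(L)`
   momenta); stub kills once a line is picked (payload `targets` empty this cycle). [folklore] -/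
theorem whyItResists : True := trivial

/-! ## §6 Attack log (cycle 1) -/

/-- ATTACK LOG, cycle 1 (2026-08-17), numbers not adjectives.
* read-back / elaboration: probe rc 0; crux consumed only in `infiniteVolumeFirst_tightnessExchange_proof`
  along a subsequence with `LRO_L → 0` and for `η <` half the limit atom (strategist FINDING: only the
  small-zero-mode half `NoSlidingCondensate` is load-bearing for the route; recommendation R1 on the item).
* triviality: `simp/decide/aesop` pointless (real analysis over `Classical.choice` ground states); Parseval
  threshold `η ≥ 32` (§1); empty window below `εL < 2π` (§1).
* vacuity: no — admissible families exist for every `(U, δ ≥ -1)`, including the degenerate side `L = 0`.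
* hypothesis mutation: GS ↦ sector (FALSE, landed); GS ↦ `E ≤ E₀ + 8π²` (FALSE mod LRO, landed);
  `m ≠ 0` dropped (FALSE mod rank-2 crux, landed); normalisation dropped (collapses, §2); `Even L` dropped,
  `0 < δ`, `δ < 1/2`, `U < U₁` dropped — no provable effect (odd/other-filling/strong-coupling ground states are
  as uncontrolled as the crux's); `∃ ε ∀ L` ↦ `∀ L ∃ ε` (EMPTY, §1); family-dependence of `ε` (NO EFFECT, §4, landed).
* strengthenings: AllSectorStates (refuted = Mutation 1); WithZeroMode (refuted mod rank-2);
  UniformFlatWindow, CouplingUniformWindow, linear rate (= sibling 1089, nine dead leads) — not decidable here.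
* small models / compute: none run (item 2 of `whyItResists`); sibling `U = 0` Wick job `j015079` reused
  (`T_ε ≈ κ ε² L²`, `κ ≤ 0.21`, flat).
* literature: local `lit search` DOWN during this cycle (searchd connection reset ×4, 07:10Z–07:30Z; arXiv
  remote 0 rows) — search degraded; `lit galaxy search --star all` substring "sliding condensate ground state",
  "generalized Bose-Einstein condensation interacting": 0 rows; `lit galaxy search --mode bm25 --star pdf`
  (FFLO / small-momentum PDW in the weakly repulsive doped Hubbard model without imbalance): 12 rows, best =
  Qin–Schäfer–Andergassen–Corboz–Gull 2022 review (read §4 pp. 11–12: weak-coupling GS = uniform d-wave +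
  (in)commensurate AF, no PDW/PS at weak coupling; competing stripe/PDW states are a STRONG-coupling, `t'`/`t-J`
  phenomenon, §5), Chakravarty–Kivelson 2001, Toschi et al. 2005 (attractive model) — nothing proposing a
  `|Q| → 0` pair condensate.  Relied also on the strategist's and the sibling disprover's logged searches
  (generalised condensation: LSSY 2005 Ch. 5, Girardeau 1962, van den Berg–Lewis–Pulé 1986, Michoel–Verbeure
  1999; twist: LSM 1961, Watanabe 2019; PS/PDW: Misawa–Imada 2014, Qin et al. 2020).  To re-run when searchd
  returns: "generalized condensation fermion pairs ground state", "Hubbard weak coupling phase separation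
  fixed doping renormalization group".
* bearing on the crux ideas filed meanwhile (`Cruxes/NoInfraredPileUp/Ideas/*`, not triaged here): every
  energy-reward / coercivity lever (`unit-norm-window-reward`: `H − E_L ⪰ (κ/L²)(𝒲_ε − ηL²)`) is CALIBRATED by
  §2 — on the twisted Dicke condensate it is consistent only because that state's kinetic excess is extensive,
  and on the LSM-twisted ground state (energy `≤ E₀ + 8π²`, window weight `≥ aL²/2 − 32π²`) it forces
  `κ ≤ 16π²/(a − 2η)` up to `O(L⁻²)`: a flat reward coefficient can never exceed the inverse condensate density
  scale, `κ = O(1/a) ~ e^{+2c/U²}` is the most the wall allows and `η < a/2` is where the route needs it;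
  current-based levers (`bloch-vise-superfluid-fraction`, Bloch's bound on the TOTAL current) must also handle
  the currentless standing wave `(G₊ψ + G₋ψ)/√2` of two opposite LSM boosts (same sector, energy `≤ E₀ + 8π²`,
  half the window weight of each boost up to the cross term) — the strategist's §2 "Bloch" row; density levers
  (`phonon-equipartition-compressibility`) must avoid bounding the window through any quantity continuous at
  `q = 0` (§3).  These are remarks for the triage panel, not verdicts.
* landed this cycle: p144890 AllSectorStates, p145689 NearGroundStates, p145822 WithZeroMode,
  p145826 UniformNormalForm, p146003 PileUpForcesLimitAtom, p146252 KillIsCondensation (all `--supports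
  stmt-HubbardSuperconductivity-18534`).
  [folklore] -/
theorem attackLog : True := trivial

end Summit.HubbardSuperconductivity.HubbardSuperconductivity.Cruxes.NoInfraredPileUp.Disproof
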